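import Summits.ABC.IUTFork.Conditional.AbcOfSHwBadMReyssatApex
import Summits.ABC.IUTFork.Conditional.FreyLegendreP6Reyssat
import Summits.ABC.IUTFork.Cor312GenuineMWildLowerBound
import Mathlib.Analysis.Real.Pi.Bounds
import HarnessLib

/-!
# Branch C / R-W, M line — ROW «W:M-SHALLOW-REYSSAT-17-19» (abc-iut-plan RULING C-R73 (2)): the Reyssat datum `λ = 2/23⁵` (`2 + 3¹⁰·109 = 23⁵`)
# is M-SHALLOW at EVERY member of EVERY genuine Θ-volume datum also at `l = 17` and `l = 19`; admissibility and the Szpiro-bad guard there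

PROOF-ONLY file (no `def`, no new `Prop`, no instance, no notation; nothing re-typed) of the abc-iut cell (D-0079 R-W numerics crew seat abc-iut-W-num-4,
gen 4). Sequel of abc-iut-C-cert-3's `AbcOfSHwBadMShallowReyssat` (p482049, `l = 13`) / `AbcOfSHwBadMReyssatApex` (p483052), whose §1/§2/§4 lemmas
(`ReyssatM.depthConstants_ge/_ge_three`, `logRadiusB_ge_of_pow_le`, `ord_jInv_of_mem/_nonneg_of_not_mem`, `mem_UP`, `admitsCore`) are consumed BY NAME;
the LOWER local types are abc-iut-W-num-6's `Cor312GenuineMWildLowerBound` (p480786); (P6) at `(2/23⁵, 17 | 19)` is abc-iut-w6-d102's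
`FreyP6Reyssat.condP6_seventeen/_nineteen` (p482354). TAKES NO SIDE on [IUTchIII] Cor. 3.12 or on any author.
* §1 `ReyssatM.one_div_sub_two_le_logRadiusA` (`a ≥ 1/(p−2)`, the extra `1/21` over `23` that `l = 19` needs) and `ReyssatM.expo_nonneg_of_le` (the
  label arithmetic in ENDPOINT form: `0 ≤ i ≤ N`, `μN − 1/(N+2) ≤ X ⟹ (i+2)X + 1 − μ·i(i+2) ≥ 0` — no `interval_cases`).
* §2 **`ReyssatM.not_exists_deep_of_eq`** (`l = 17 ∨ l = 19`) / **`_seventeen`** / **`_nineteen`** — the member type of the `hshallow` binder of the M apex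
  socket `not_hSHwBad_M_of_refuted` (p468391 §1) at `(ratPoint (2/23⁵), l)` VERBATIM holds for EVERY `T`: good members `‖t_q‖ = 1`; bad members over
  `p ∈ {3, 23, 109}` with `‖t_{q,x₀}‖ = p^{−h_p/(2l)}` (`h = 20, 10, 2`; abc-iut-w5-d166's `norm_tqM_eq_rpow_ord_rat`) and LOWER local type `3l ∣ e` over `3`
  (`t = 10`) and `23` (`t = 5`) (`GenuineM.three_mul_prime_dvd_absRamificationIdx_kOfM_ratPoint`), `l ∣ e` over `109`; so `d+a+b ≥ 5 − 2/(3l) | 2 + 1/21 −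
  2/(3l) | 1 − 1/l` against the endpoint needs `(h/(2l))·(l−3)/2 − 2/(l+1)` = `613/153 | 298/153 | 46/153` at `17` and `781/190 | 381/190 | 61/190` at
  `19`; the `23`-column at `l = 19` passes by `2409/1197 − 381/190 ≈ 0.0073` (it FAILS with `a ≥ 1/e` only — hence §1). WHY NOT ALL `l`: for the tabulated
  `l ≥ 89` the same bounds do NOT reach the need over `23` (`e = 3l` is allowed by everything the tree proves; the numerics' `e_w = 6l` there is an extra
  assumption) — no claim is made beyond `l ∈ {13, 17, 19}`.
* §3 admissibility AS TYPED at `l ∈ {17, 19}` (C-cert-3's `l = 13` pattern): `ReyssatM.condP2_of_eq` (`l ∤ 20, 10, 2`), `condP5_of_eq` (the place over `3`),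
  the Szpiro-bad guard `szpiroBad_of_eq` VERBATIM at `l` — right disjunct, cleared of `(l+4)(l−3)`: `187·log π < 346 log 3 + 101 log 23 − 95 log 109` (`17`,
  certificate `63¹⁸⁷·109⁹⁵ < 3³⁴⁶·23¹⁰¹·20¹⁸⁷`, margin ≈ 1.5 nats) and `171·log π < 325 log 3 + 95 log 23 − 89 log 109` (`19`, `63¹⁷¹·109⁸⁹ < 3³²⁵·23⁹⁵·20¹⁷¹`,
  ≈ 1.8 nats; at `13` it was ≈ 0.3) — and `nonempty_thetaVolumeDatumAt_of_eq` with NO hypothesis ((P6) by p482354).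
The apices `not_hSHwBad_M_reyssat_seventeen_holds/_nineteen_holds` (hypothesis-free, conclusion = the SAME closed proposition as abc-iut-C-cert-3's
`not_hSHwBad_M_reyssat_thirteen_holds`, p483704) are filed separately (`AbcOfSHwBadMReyssatApexHigherHolds`) — census value: three Szpiro-bad data
refute the M window binder independently. NUMERICS OF RECORD (not used by the kernel): abc-iut-rw-num-lead's `M-SHALLOW-INPUTS.tsv` 45a0a9129e6618d8
(tightest tabulated slack `25/34` at `(17, 23, j = 8)`, `17/57` at `(19, 23, j = 9)`).
HONEST FRAMING: statements about OUR sharp M setting's explicit `(d, a, b)` depth form at one rational datum; «refuted as typed» ≠ «refuted in print»;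
nothing here asserts that abc is proved or refuted, or that [IUTchIII] Cor. 3.12 / Thm. 3.11 or [IUTchIV] Thm. 1.10 holds or fails; typed ≠ proved;
instantiated ≠ endorsed; NO abc claim. [claim: Mochizuki2012, status: disputed] for every IUT sentence quoted. [cite: Mochizuki2012, IUTchI Ex. 3.2 (iv)
p. 71; IUTchIII Cor. 3.12 Step (xi-f) p. 184; IUTchIV Prop. 1.2 (i)(ii) p. 10, Thm. 1.10 p. 22–23, Cor. 2.2 (ii) proof (P2)(P5)(P6)(P7) p. 43–46]
[cite: SerreLocalFields1979, Ch. III §6 Prop. 13] [cite: SilvermanATAEC1994, V.5 Thm. 5.3 and Cor. 5.4] [cite: DupuyHilado2025, §3.3, §3.4]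
-/

noncomputable section

open Set Function NumberField IsDedekindDomain

namespace Summit.ABC.IUTFork.Conditional

open Thm311 Thm311.Real Cor312 Cor312Vol Cor312Prov Literature.IUT.LogThetaLattice Literature.IUT.LogVolume
  Literature.IUT.HodgeTheaters Literature.IUT.LogVolume.ThetaData Literature.IUT.LogVolume.Cor22
open Literature.NumberTheory.NumberFields Literature.NumberTheory.GaloisRepresentations.Ultrametric
open Literature.NumberTheory.DiophantineGeometry Literature.NumberTheory.DiophantineGeometry.GenEll Summit.ABC.ABC.Theorems
open scoped Classical

/-! ## §1. Two more classical bounds -/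

/-- **`a ≥ 1/(p − 2)` for `p > 2`**: `a = ⌈e/(p−2)⌉/e ≥ (e/(p−2))/e`. (At `p = 23`: `a ≥ 1/21`, the extra `1/21` the top label at `l = 19` needs.)
[cite: Mochizuki2012, IUTchIV Prop. 1.2 p. 10] [claim: Mochizuki2012, status: disputed] -/
theorem ReyssatM.one_div_sub_two_le_logRadiusA {p e : ℕ} (hp : 2 < p) (he : 1 ≤ e) :
    1 / ((p : ℝ) - 2) ≤ logRadiusA p e := by
  have hp2 : (0 : ℝ) < (p : ℝ) - 2 := by
    have : (2 : ℝ) < p := by exact_mod_cast hp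
    linarith
  have he0 : (0 : ℝ) < e := by exact_mod_cast he
  unfold logRadiusA
  rw [if_neg (by omega)]
  have hceil : (e : ℝ) / ((p : ℝ) - 2) ≤ (⌈(e : ℝ) / ((p : ℝ) - 2)⌉ : ℝ) := Int.le_ceil _
  calc 1 / ((p : ℝ) - 2) = ((e : ℝ) / ((p : ℝ) - 2)) / e := by field_simp
    _ ≤ (⌈(e : ℝ) / ((p : ℝ) - 2)⌉ : ℝ) / e := div_le_div_of_nonneg_right hceil he0.le

/-- **The label arithmetic, endpoint form**: for `0 ≤ i ≤ N`, `0 ≤ μ` and `μ·N − 1/(N+2) ≤ X`,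
`0 ≤ (i+2)·X + 1 − μ·(i(i+2))` — since `(i+2)(X − μ i) + 1 ≥ (i+2)(μ(N − i) − 1/(N+2)) + 1 ≥ 1 − (i+2)/(N+2) ≥ 0`
(`X = d+a+b`, `μ = −ord_p j/(2l)`, `N = l⋆ − 1`, `i(i+2) = (i+1)² − 1`). [cite: Mochizuki2012, IUTchIV Thm. 1.10 Step (v) p. 27–28] -/
theorem ReyssatM.expo_nonneg_of_le {X μ i N : ℝ} (hi0 : 0 ≤ i) (hiN : i ≤ N) (hμ : 0 ≤ μ) (hX : μ * N - 1 / (N + 2) ≤ X) :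
    0 ≤ (i + 2) * X + 1 + -μ * (i * (i + 2)) := by
  have hN2 : (0 : ℝ) < N + 2 := by linarith
  have h1 : 0 ≤ μ * (N - i) * (i + 2) := mul_nonneg (mul_nonneg hμ (by linarith)) (by linarith)
  have h2 : (i + 2) * (1 / (N + 2)) ≤ 1 := by
    rw [← div_eq_mul_one_div, div_le_one hN2]; linarith
  have h3 : (i + 2) * (μ * N - 1 / (N + 2)) ≤ (i + 2) * X := mul_le_mul_of_nonneg_left hX (by linarith)
  have h4 : (i + 2) * (μ * N - 1 / (N + 2)) = μ * (N - i) * (i + 2) + μ * (i * (i + 2)) - (i + 2) * (1 / (N + 2)) := by ring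
  linarith

/-! ## §2. M-shallowness of every genuine datum over `(2/23⁵, l)`, `l ∈ {17, 19}` -/

/-- **M-SHALLOWNESS AT THE REYSSAT DATUM, `l ∈ {17, 19}`.** For EVERY genuine Θ-volume datum `T` over `(ratPoint (2/23⁵), l)`, NO finite place `u`
of `ℚ`, label `i + 1 ≤ l⋆` and member `x₀ ∈ V̲_u` of the M-fibre satisfy `p_u^{((i+2)(d+a+b)+1)}·‖t_{q,x₀}‖^{(i+1)²−1} < 1` — the member type of the
`hshallow` binder of abc-iut-C-cert-3's socket `not_hSHwBad_M_of_refuted` (p468391 §1) at `(2/23⁵, l)`, VERBATIM. Per member: GOOD ⇒ `‖t_q‖ = 1`,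
exponent `≥ 1`; BAD ⇒ over `p ∈ {3, 23, 109}` (`ReyssatM.ord_jInv_of_mem/_nonneg_of_not_mem`) with `‖t_{q,x₀}‖ = p^{−h_p/(2l)}`, `h_p = 20, 10, 2`
(`norm_tqM_eq_rpow_ord_rat`), and the LOWER local type of abc-iut-W-num-6's `Cor312GenuineMWildLowerBound`: `3l ∣ e` over `3` (`t = 10`) and over
`23` (`t = 5`) (`GenuineM.three_mul_prime_dvd_absRamificationIdx_kOfM_ratPoint`), `l ∣ e` over `109`; whence `d+a+b ≥ 5 − 2/(3l)` over `3`
(`ReyssatM.depthConstants_ge_three`, `k = 3`), `≥ 2 + 1/21 − 2/(3l)` over `23` (`d ≥ (e−1)/e`, `a ≥ 1/21`, `b ≥ 1 − 1/e`), `≥ 1 − 1/l` over `109`,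
against the endpoint needs `μN − 1/(N+2)` (`N = (l−3)/2`, `μ = h_p/(2l)`): `70/17 − 1/9 | 35/17 − 1/9 | 7/17 − 1/9` at `17`, `80/19 − 1/10 |
40/19 − 1/10 | 8/19 − 1/10` at `19` — the `23`-column at `l = 19` passes by `2409/1197 − 381/190 ≈ 0.007`.
[cite: Mochizuki2012, IUTchI Ex. 3.2 (iv) p. 71; IUTchIV Prop. 1.2 (i)(ii) p. 10, Cor. 2.2 (ii) proof (P5) p. 46] [cite: DupuyHilado2025, §3.3, §3.4]
[cite: SerreLocalFields1979, Ch. III §6 Prop. 13] [cite: SilvermanATAEC1994, V.5 Thm. 5.3 and Cor. 5.4] [claim: Mochizuki2012, status: disputed] -/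
theorem ReyssatM.not_exists_deep_of_eq {l : ℕ} (hl : l = 17 ∨ l = 19) (T : Cor22.ThetaVolumeDatumAt (ratPoint (((2 : ℕ) : ℚ) / (23 ^ 5 : ℕ))) l) :
    letI := T.instFieldF; letI := T.instNumberFieldF; letI := T.instAlgebraF; letI := T.instFieldK
    letI := T.instNumberFieldK; letI := T.instAlgebraK; letI := T.instFieldFbar; letI := T.instAlgebraFbar
    letI := T.instAlgebraKFbar; letI := T.instIsElliptic
    ¬ (∃ (u : FinitePlace ℚ) (i : Fin (thetaIndexOfInitial T.D).lstar) (x₀ : (thetaIndexOfInitial T.D).Fibre (Val.non u)),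
      ((ratChar u : ℕ) : ℝ) ^ ((((i : ℕ) : ℝ) + 2) *
      (differentOrd (ratChar u) (kOfM T.D (ratChar u) u (natCast_ratChar_mem u) x₀)
      + logRadiusA (ratChar u) (absRamificationIdx (ratChar u) (kOfM T.D (ratChar u) u (natCast_ratChar_mem u) x₀))
      + logRadiusB (ratChar u) (absRamificationIdx (ratChar u) (kOfM T.D (ratChar u) u (natCast_ratChar_mem u) x₀))) + 1) *
      ‖tqM T.D (ratChar u) u (natCast_ratChar_mem u) (ideleDataOf T.D T.isVolumeInputOf) x₀‖ ^ (((i : ℕ) + 1) ^ 2 - 1) < 1) := by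
  letI := T.instFieldF; letI := T.instNumberFieldF; letI := T.instAlgebraF; letI := T.instFieldK
  letI := T.instNumberFieldK; letI := T.instAlgebraK; letI := T.instFieldFbar; letI := T.instAlgebraFbar
  letI := T.instAlgebraKFbar; letI := T.instIsElliptic
  rintro ⟨u, i, x₀, hlt⟩
  haveI hpfact : Fact (ratChar u).Prime := inferInstance
  have hp1 : (1 : ℝ) < ((ratChar u : ℕ) : ℝ) := by exact_mod_cast hpfact.out.one_lt
  have hp0 : (0 : ℝ) < ((ratChar u : ℕ) : ℝ) := lt_trans zero_lt_one hp1
  have hl5 : 5 ≤ l := by rcases hl with rfl | rfl <;> norm_num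
  have hl0 : (0 : ℝ) < (l : ℝ) := by exact_mod_cast (show 0 < l by omega)
  set K₀ := kOfM T.D (ratChar u) u (natCast_ratChar_mem u) x₀ with hK₀def
  set e : ℕ := absRamificationIdx (ratChar u) K₀ with hedef
  set X : ℝ := differentOrd (ratChar u) K₀ + logRadiusA (ratChar u) e + logRadiusB (ratChar u) e with hXdef
  have he1 : 1 ≤ e := absRamificationIdx_pos (ratChar u) K₀
  have he0 : (0 : ℝ) < (e : ℝ) := by exact_mod_cast he1
  have hdab : 0 ≤ X := GenuineMShrink2.depthConstants_nonneg (ratChar u) K₀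
  -- the label: `i ≤ N = (l − 3)/2`
  have hlstar : (thetaIndexOfInitial T.D).lstar = (l - 1) / 2 := rfl
  have hiN : 2 * (i : ℕ) + 3 ≤ l := by
    have h1 : (i : ℕ) < (thetaIndexOfInitial T.D).lstar := i.2
    rcases hl with rfl | rfl <;> omega
  have hiNR : ((i : ℕ) : ℝ) ≤ ((l : ℝ) - 3) / 2 := by
    rw [le_div_iff₀ (by norm_num : (0 : ℝ) < 2)]
    have : (((2 * (i : ℕ) + 3 : ℕ)) : ℝ) ≤ (l : ℝ) := by exact_mod_cast hiN
    push_cast at this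
    linarith
  have hi0 : (0 : ℝ) ≤ ((i : ℕ) : ℝ) := Nat.cast_nonneg _
  have hB : ((((i : ℕ) + 1) ^ 2 - 1 : ℕ) : ℝ) = ((i : ℕ) : ℝ) * (((i : ℕ) : ℝ) + 2) := by
    have : 1 ≤ ((i : ℕ) + 1) ^ 2 := Nat.one_le_pow _ _ (by omega)
    push_cast [Nat.cast_sub this]
    ring
  by_cases hS : placeModOfM T.D u x₀ ∈ (ThetaData.pilotData T.D).S
  · -- a BAD member: `p ∈ {3, 23, 109}` and `‖t_{q,x₀}‖ = p^{ord_p j(2/23⁵)/(2l)}`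
    set v : HeightOneSpectrum (𝓞 ℚ) := finBelow ℚ (fieldOfModuli T.E) (placeModOfM T.D u x₀) with hvdef
    have hgen : Rat.HeightOneSpectrum.natGenerator v = ratChar u :=
      natGenerator_finBelow_placeModOfM T.D (ratChar u) u (natCast_ratChar_mem u) x₀
    have hjF : T.E.j = (((Cor22.jInv (((2 : ℕ) : ℚ) / (23 ^ 5 : ℕ)) : ℚ)) : T.F) := by rw [T.j_eq]; exact eq_ratCast _ _
    have hnorm := norm_tqM_eq_rpow_ord_rat T.D (ratChar u) u (natCast_ratChar_mem u) (ideleDataOf T.D T.isVolumeInputOf) x₀ hS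
      (Cor22.jInv (((2 : ℕ) : ℚ) / (23 ^ 5 : ℕ))) hjF
    -- `ord_v j < 0` at the bad member, hence `p ∈ {3, 23, 109}`
    have hneg : Literature.IUT.LogVolume.ord ℚ v (Cor22.jInv (((2 : ℕ) : ℚ) / ((23 ^ 5 : ℕ) : ℚ))) < 0 := by
      have h := (ThetaData.pilotData T.D).ord_jE_neg _ hS
      rw [ThetaData.pilotData_jE, jMod_eq_algebraMap_of_j_eq (E := T.E) _ hjF] at h
      exact (Cor22.ord_algebraMap_neg_iff _ _).mp h
    have hmem : Rat.HeightOneSpectrum.natGenerator v ∈ ({3, 23, 109} : Finset ℕ) := by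
      by_contra hnot
      exact absurd (ReyssatM.ord_jInv_nonneg_of_not_mem v hnot) (not_le.mpr hneg)
    have hord := ReyssatM.ord_jInv_of_mem v hmem
    rw [hgen] at hord hmem
    rw [hnorm, ← Real.rpow_natCast, ← Real.rpow_mul hp0.le, ← Real.rpow_add hp0, hB] at hlt
    refine absurd hlt (not_lt.mpr (Real.one_le_rpow hp1.le ?_))
    simp only [Finset.mem_insert, Finset.mem_singleton] at hmem
    rcases hmem with hpu | hpu | hpu
    · -- over `3`: `h = 20`, `3l ∣ e` (`t = 10`), `d + a + b ≥ 2 + 3 − 2/(3l)`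
      have hl3 : ratChar u ≠ l := by rw [hpu]; rcases hl with rfl | rfl <;> norm_num
      have h3l : 3 * l ∣ e := GenuineM.three_mul_prime_dvd_absRamificationIdx_kOfM_ratPoint T u (by rw [hpu]; norm_num) hl3
        (t := 10) (by norm_num) (by norm_num)
        (fun w hw => by rw [ReyssatM.ord_jInv_of_mem w (by rw [hw, hpu]; decide), hw, hpu]; norm_num) x₀
      have hle : 3 * l ≤ e := Nat.le_of_dvd he1 h3l
      have hX : (2 : ℝ) + (3 : ℕ) - 2 / ((3 * l : ℕ) : ℝ) ≤ X :=
        ReyssatM.depthConstants_ge_three (ratChar u) K₀ hpu (e₀ := 3 * l) (k := 3) (by omega) hle (by rcases hl with rfl | rfl <;> norm_num)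
      have hordv : ((Literature.IUT.LogVolume.ord ℚ v (Cor22.jInv (((2 : ℕ) : ℚ) / ((23 ^ 5 : ℕ) : ℚ))) : ℤ) : ℝ) = -20 := by
        rw [hord, hpu]; norm_num
      rw [hordv]
      rcases hl with rfl | rfl
      · have key := ReyssatM.expo_nonneg_of_le (X := X) (i := ((i : ℕ) : ℝ)) (μ := 10 / 17) (N := 7) hi0 (by norm_num at hiNR ⊢; linarith)
          (by norm_num) (by norm_num at hX ⊢; linarith)
        push_cast; linarith
      · have key := ReyssatM.expo_nonneg_of_le (X := X) (i := ((i : ℕ) : ℝ)) (μ := 10 / 19) (N := 8) hi0 (by norm_num at hiNR ⊢; linarith)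
          (by norm_num) (by norm_num at hX ⊢; linarith)
        push_cast; linarith
    · -- over `23`: `h = 10`, `3l ∣ e` (`t = 5`), `d + a + b ≥ 2 + 1/21 − 2/(3l)`
      have hl23 : ratChar u ≠ l := by rw [hpu]; rcases hl with rfl | rfl <;> norm_num
      have h3l : 3 * l ∣ e := GenuineM.three_mul_prime_dvd_absRamificationIdx_kOfM_ratPoint T u (by rw [hpu]; norm_num) hl23
        (t := 5) (by norm_num) (by norm_num)
        (fun w hw => by rw [ReyssatM.ord_jInv_of_mem w (by rw [hw, hpu]; decide), hw, hpu]; norm_num) x₀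
      have hle : 3 * l ≤ e := Nat.le_of_dvd he1 h3l
      have hleR : ((3 * l : ℕ) : ℝ) ≤ e := by exact_mod_cast hle
      have hd : ((e : ℝ) - 1) / e ≤ differentOrd (ratChar u) K₀ := sub_one_div_le_differentOrd (ratChar u) K₀
      have hd' : 1 - 1 / (e : ℝ) ≤ differentOrd (ratChar u) K₀ := by rw [sub_div, div_self he0.ne'] at hd; exact hd
      have ha : (1 : ℝ) / 21 ≤ logRadiusA (ratChar u) e := by
        rw [hpu]
        have h := ReyssatM.one_div_sub_two_le_logRadiusA (p := 23) (e := e) (by norm_num) he1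
        norm_num at h ⊢
        exact h
      have hb : ((1 : ℕ) : ℝ) - 1 / e ≤ logRadiusB (ratChar u) e :=
        ReyssatM.logRadiusB_ge_of_pow_le hpfact.out.one_lt he1 (by rw [hpu]; omega)
      have h3l0 : (0 : ℝ) < ((3 * l : ℕ) : ℝ) := by exact_mod_cast (show 0 < 3 * l by omega)
      have hinv : 1 / (e : ℝ) ≤ 1 / ((3 * l : ℕ) : ℝ) := one_div_le_one_div_of_le h3l0 hleR
      have hX : (2 : ℝ) + 1 / 21 - 2 / ((3 * l : ℕ) : ℝ) ≤ X := by
        have : (2 : ℝ) / ((3 * l : ℕ) : ℝ) = 2 * (1 / ((3 * l : ℕ) : ℝ)) := by ring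
        push_cast at hb
        linarith
      have hordv : ((Literature.IUT.LogVolume.ord ℚ v (Cor22.jInv (((2 : ℕ) : ℚ) / ((23 ^ 5 : ℕ) : ℚ))) : ℤ) : ℝ) = -10 := by
        rw [hord, hpu]; norm_num
      rw [hordv]
      rcases hl with rfl | rfl
      · have key := ReyssatM.expo_nonneg_of_le (X := X) (i := ((i : ℕ) : ℝ)) (μ := 5 / 17) (N := 7) hi0 (by norm_num at hiNR ⊢; linarith)
          (by norm_num) (by norm_num at hX ⊢; linarith)
        push_cast; linarith
      · have key := ReyssatM.expo_nonneg_of_le (X := X) (i := ((i : ℕ) : ℝ)) (μ := 5 / 19) (N := 8) hi0 (by norm_num at hiNR ⊢; linarith)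
          (by norm_num) (by norm_num at hX ⊢; linarith)
        push_cast; linarith
    · -- over `109`: `h = 2`, `l ∣ e`, `d + a + b ≥ 1 − 1/l`
      have hl109 : ratChar u ≠ l := by rw [hpu]; rcases hl with rfl | rfl <;> norm_num
      have hld : l ∣ e := GenuineM.prime_dvd_absRamificationIdx_kOfM_ratPoint T u (by rw [hpu]; norm_num) hl109
        (fun w hw => by rw [ReyssatM.ord_jInv_of_mem w (by rw [hw, hpu]; decide), hw, hpu]; norm_num) x₀
      have hle : l ≤ e := Nat.le_of_dvd he1 hld
      have hX : (1 : ℝ) + (0 : ℕ) - 1 / (l : ℝ) ≤ X :=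
        ReyssatM.depthConstants_ge (ratChar u) K₀ (e₀ := l) (k := 0) (by omega) hle (by rw [hpu]; omega)
      have hordv : ((Literature.IUT.LogVolume.ord ℚ v (Cor22.jInv (((2 : ℕ) : ℚ) / ((23 ^ 5 : ℕ) : ℚ))) : ℤ) : ℝ) = -2 := by
        rw [hord, hpu]; norm_num
      rw [hordv]
      rcases hl with rfl | rfl
      · have key := ReyssatM.expo_nonneg_of_le (X := X) (i := ((i : ℕ) : ℝ)) (μ := 1 / 17) (N := 7) hi0 (by norm_num at hiNR ⊢; linarith)
          (by norm_num) (by norm_num at hX ⊢; linarith)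
        push_cast; linarith
      · have key := ReyssatM.expo_nonneg_of_le (X := X) (i := ((i : ℕ) : ℝ)) (μ := 1 / 19) (N := 8) hi0 (by norm_num at hiNR ⊢; linarith)
          (by norm_num) (by norm_num at hX ⊢; linarith)
        push_cast; linarith
  · -- a GOOD member: the q-idele is a unit and the exponent is `≥ 1`
    rw [norm_tqM_eq_one_of_not_mem T.D (ratChar u) u (natCast_ratChar_mem u) (ideleDataOf T.D T.isVolumeInputOf) x₀ hS,
      one_pow, mul_one] at hlt
    have hi : (0 : ℝ) ≤ ((i : ℕ) : ℝ) + 2 := by positivity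
    have hA : 0 ≤ (((i : ℕ) : ℝ) + 2) * X + 1 := by nlinarith [mul_nonneg hi hdab]
    exact absurd hlt (not_lt.mpr (Real.one_le_rpow hp1.le hA))

/-- **`l = 17`.** [cite: Mochizuki2012, IUTchIV Prop. 1.2 (i)(ii) p. 10, Cor. 2.2 (ii) proof (P5) p. 46] [claim: Mochizuki2012, status: disputed] -/
theorem ReyssatM.not_exists_deep_seventeen (T : Cor22.ThetaVolumeDatumAt (ratPoint (((2 : ℕ) : ℚ) / (23 ^ 5 : ℕ))) 17) :
    letI := T.instFieldF; letI := T.instNumberFieldF; letI := T.instAlgebraF; letI := T.instFieldK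
    letI := T.instNumberFieldK; letI := T.instAlgebraK; letI := T.instFieldFbar; letI := T.instAlgebraFbar
    letI := T.instAlgebraKFbar; letI := T.instIsElliptic
    ¬ (∃ (u : FinitePlace ℚ) (i : Fin (thetaIndexOfInitial T.D).lstar) (x₀ : (thetaIndexOfInitial T.D).Fibre (Val.non u)),
      ((ratChar u : ℕ) : ℝ) ^ ((((i : ℕ) : ℝ) + 2) *
      (differentOrd (ratChar u) (kOfM T.D (ratChar u) u (natCast_ratChar_mem u) x₀)
      + logRadiusA (ratChar u) (absRamificationIdx (ratChar u) (kOfM T.D (ratChar u) u (natCast_ratChar_mem u) x₀))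
      + logRadiusB (ratChar u) (absRamificationIdx (ratChar u) (kOfM T.D (ratChar u) u (natCast_ratChar_mem u) x₀))) + 1) *
      ‖tqM T.D (ratChar u) u (natCast_ratChar_mem u) (ideleDataOf T.D T.isVolumeInputOf) x₀‖ ^ (((i : ℕ) + 1) ^ 2 - 1) < 1) :=
  ReyssatM.not_exists_deep_of_eq (Or.inl rfl) T

/-- **`l = 19`.** [cite: Mochizuki2012, IUTchIV Prop. 1.2 (i)(ii) p. 10, Cor. 2.2 (ii) proof (P5) p. 46] [claim: Mochizuki2012, status: disputed] -/
theorem ReyssatM.not_exists_deep_nineteen (T : Cor22.ThetaVolumeDatumAt (ratPoint (((2 : ℕ) : ℚ) / (23 ^ 5 : ℕ))) 19) :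
    letI := T.instFieldF; letI := T.instNumberFieldF; letI := T.instAlgebraF; letI := T.instFieldK
    letI := T.instNumberFieldK; letI := T.instAlgebraK; letI := T.instFieldFbar; letI := T.instAlgebraFbar
    letI := T.instAlgebraKFbar; letI := T.instIsElliptic
    ¬ (∃ (u : FinitePlace ℚ) (i : Fin (thetaIndexOfInitial T.D).lstar) (x₀ : (thetaIndexOfInitial T.D).Fibre (Val.non u)),
      ((ratChar u : ℕ) : ℝ) ^ ((((i : ℕ) : ℝ) + 2) *
      (differentOrd (ratChar u) (kOfM T.D (ratChar u) u (natCast_ratChar_mem u) x₀)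
      + logRadiusA (ratChar u) (absRamificationIdx (ratChar u) (kOfM T.D (ratChar u) u (natCast_ratChar_mem u) x₀))
      + logRadiusB (ratChar u) (absRamificationIdx (ratChar u) (kOfM T.D (ratChar u) u (natCast_ratChar_mem u) x₀))) + 1) *
      ‖tqM T.D (ratChar u) u (natCast_ratChar_mem u) (ideleDataOf T.D T.isVolumeInputOf) x₀‖ ^ (((i : ℕ) + 1) ^ 2 - 1) < 1) :=
  ReyssatM.not_exists_deep_of_eq (Or.inr rfl) T

/-! ## §3. Admissibility AS TYPED and the Szpiro-bad guard at `(2/23⁵, l)`, `l ∈ {17, 19}` (abc-iut-C-cert-3's `l = 13` pattern, p483052) -/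

/-- **(P2) at `l ∈ {17, 19}`**: `l` divides no nonzero local height (`h_p ∈ {20, 10, 2}`). [cite: Mochizuki2012, IUTchIV Cor. 2.2 (ii) proof (P2) p. 45]
[claim: Mochizuki2012, status: disputed] -/
theorem ReyssatM.condP2_of_eq {l : ℕ} (hl : l = 17 ∨ l = 19) : Cor22.CondP2 (ratPoint (((2 : ℕ) : ℚ) / (23 ^ 5 : ℕ))) l := by
  have key : ∀ w : HeightOneSpectrum (𝓞 ℚ), ord ℚ w (Cor22.jInv (((2 : ℕ) : ℚ) / (23 ^ 5 : ℕ))) < 0 →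
      ¬ ((l : ℤ) ∣ ord ℚ w (Cor22.jInv (((2 : ℕ) : ℚ) / (23 ^ 5 : ℕ)))) := by
    intro w hneg
    by_cases hw : Rat.HeightOneSpectrum.natGenerator w ∈ ({3, 23, 109} : Finset ℕ)
    · rw [ReyssatM.ord_jInv_of_mem w hw]
      simp only [Finset.mem_insert, Finset.mem_singleton] at hw
      rcases hl with rfl | rfl <;> rcases hw with h | h | h <;> (rw [h]; norm_num)
    · exact absurd hneg (not_lt.mpr (ReyssatM.ord_jInv_nonneg_of_not_mem w hw))
  intro v hneg
  exact key v hneg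

/-- **(P5) at `l ∈ {17, 19}`**: the place over `3` is bad and divides neither `2` nor `l`. [cite: Mochizuki2012, IUTchIV Cor. 2.2 (ii) proof (P5) p. 46]
[claim: Mochizuki2012, status: disputed] -/
theorem ReyssatM.condP5_of_eq {l : ℕ} (hl : l = 17 ∨ l = 19) : Cor22.CondP5 (ratPoint (((2 : ℕ) : ℚ) / (23 ^ 5 : ℕ))) l := by
  have hgen : Rat.HeightOneSpectrum.natGenerator ((Rat.HeightOneSpectrum.primesEquiv (R := 𝓞 ℚ)).symm ⟨3, by norm_num⟩) = 3 :=
    congrArg Subtype.val ((Rat.HeightOneSpectrum.primesEquiv (R := 𝓞 ℚ)).apply_symm_apply ⟨3, by norm_num⟩)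
  have key : ∃ w : HeightOneSpectrum (𝓞 ℚ), ord ℚ w (Cor22.jInv (((2 : ℕ) : ℚ) / (23 ^ 5 : ℕ))) < 0 ∧
      ((2 : ℕ) : 𝓞 ℚ) ∉ w.asIdeal ∧ ((l : ℕ) : 𝓞 ℚ) ∉ w.asIdeal := by
    refine ⟨(Rat.HeightOneSpectrum.primesEquiv (R := 𝓞 ℚ)).symm ⟨3, by norm_num⟩, ?_, ?_, ?_⟩
    · rw [ReyssatM.ord_jInv_of_mem _ (by rw [hgen]; simp), hgen]
      norm_num
    · rw [UniformABCConjecture.natCast_mem_asIdeal_iff, hgen]; norm_num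
    · rw [UniformABCConjecture.natCast_mem_asIdeal_iff, hgen]; rcases hl with rfl | rfl <;> norm_num
  obtain ⟨w, h1, h2, h3⟩ := key
  exact ⟨w, h1, h2, h3⟩

set_option exponentiation.threshold 10000 in
/-- The integer certificate at `l = 17`: `63¹⁸⁷·109⁹⁵ < 3³⁴⁶·23¹⁰¹·20¹⁸⁷`. [folklore] -/
theorem ReyssatM.key_ineq_seventeen : (63 : ℕ) ^ 187 * 109 ^ 95 < 3 ^ 346 * 23 ^ 101 * 20 ^ 187 := by
  norm_num

set_option exponentiation.threshold 10000 in
/-- The integer certificate at `l = 19`: `63¹⁷¹·109⁸⁹ < 3³²⁵·23⁹⁵·20¹⁷¹`. [folklore] -/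
theorem ReyssatM.key_ineq_nineteen : (63 : ℕ) ^ 171 * 109 ^ 89 < 3 ^ 325 * 23 ^ 95 * 20 ^ 171 := by
  norm_num

/-- Log forms: `187·log π < 346·log 3 + 101·log 23 − 95·log 109` and `171·log π < 325·log 3 + 95·log 23 − 89·log 109` (`π < 3.15 = 63/20`,
Mathlib `Real.pi_lt_d2`). [folklore] -/
theorem ReyssatM.key_ineq_log_higher :
    187 * Real.log Real.pi < 346 * Real.log 3 + 101 * Real.log 23 - 95 * Real.log 109 ∧
      171 * Real.log Real.pi < 325 * Real.log 3 + 95 * Real.log 23 - 89 * Real.log 109 := by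
  have hpi : Real.log Real.pi < Real.log 63 - Real.log 20 := by
    have h := Real.log_lt_log Real.pi_pos Real.pi_lt_d2
    rw [show (3.15 : ℝ) = 63 / 20 by norm_num, Real.log_div (by norm_num) (by norm_num)] at h
    exact h
  have hk₁ : Real.log ((63 : ℕ) ^ 187 * 109 ^ 95 : ℕ) < Real.log ((3 : ℕ) ^ 346 * 23 ^ 101 * 20 ^ 187 : ℕ) :=
    Real.log_lt_log (by positivity) (by exact_mod_cast ReyssatM.key_ineq_seventeen)
  have hk₂ : Real.log ((63 : ℕ) ^ 171 * 109 ^ 89 : ℕ) < Real.log ((3 : ℕ) ^ 325 * 23 ^ 95 * 20 ^ 171 : ℕ) :=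
    Real.log_lt_log (by positivity) (by exact_mod_cast ReyssatM.key_ineq_nineteen)
  simp only [Nat.cast_mul, Nat.cast_pow, Nat.cast_ofNat] at hk₁ hk₂
  rw [Real.log_mul (by positivity) (by positivity), Real.log_mul (by positivity) (by positivity),
    Real.log_mul (by positivity) (by positivity), Real.log_pow, Real.log_pow, Real.log_pow, Real.log_pow, Real.log_pow] at hk₁ hk₂
  push_cast at hk₁ hk₂
  constructor <;> linarith

/-- **`(ratPoint (2/23⁵), l)` is SZPIRO-BAD for `l ∈ {17, 19}`** — the records' guard disjunction VERBATIM at `l`, right disjunct: `d_mod = 1`,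
`log-diff = 0`, `log q^{∤{2,l}} = 20 log 3 + 10 log 23 + 2 log 109`, `log 𝔣^{∤{2,l}} = log 3 + log 23 + log 109` (abc-iut-s2-p4's exact sums), and after
clearing `(l+4)(l−3)`: `6(l²−1)·log 𝔣 + 6l(l+5)·log π < (l+4)(l−3)·log q`, i.e. `187·log π < 346 log 3 + 101 log 23 − 95 log 109` at `17` (margin
≈ 1.5 nats) and `171·log π < 325 log 3 + 95 log 23 − 89 log 109` at `19` (margin ≈ 1.8 nats) — both from `key_ineq_log_higher`. (At `l = 13` the margin
was ≈ 0.3: the guard RELAXES as `l` grows here.) [cite: Mochizuki2012, IUTchIV Thm. 1.10 p. 22–23] [claim: Mochizuki2012, status: disputed] -/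
theorem ReyssatM.szpiroBad_of_eq {l : ℕ} (hl : l = 17 ∨ l = 19) :
    (((l : ℕ) : ℝ) + 5) / 4 < (Cor22.dmod (ratPoint (((2 : ℕ) : ℚ) / (23 ^ 5 : ℕ))) : ℝ) ∨
      6 * (l : ℕ) * ((((l : ℕ) : ℝ) + 5) - 4 * Cor22.dmod (ratPoint (((2 : ℕ) : ℚ) / (23 ^ 5 : ℕ)))) / ((((l : ℕ) : ℝ) + 4) * (((l : ℕ) : ℝ) - 3))
          * ((ratPoint (((2 : ℕ) : ℚ) / (23 ^ 5 : ℕ))).logDiff + (1 - 1 / ((l : ℕ) : ℝ)) * Cor22.logCondAvoid (ratPoint (((2 : ℕ) : ℚ) / (23 ^ 5 : ℕ))) {2, l})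
        + 6 * (l : ℕ) * (((l : ℕ) : ℝ) + 5) / ((((l : ℕ) : ℝ) + 4) * (((l : ℕ) : ℝ) - 3)) * Real.log Real.pi <
        Cor22.logQAvoid (ratPoint (((2 : ℕ) : ℚ) / (23 ^ 5 : ℕ))) {2, l} := by
  right
  have hq : (((2 : ℕ) : ℚ) / (23 ^ 5 : ℕ)) = (2 : ℚ) / 6436343 := by norm_num
  have hdmod : Cor22.dmod (ratPoint (((2 : ℕ) : ℚ) / (23 ^ 5 : ℕ))) = 1 := Cor22.dmod_eq_one_of_degree_le_one (degree_ratPoint _).le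
  have hlp : l.Prime := by rcases hl with rfl | rfl <;> norm_num
  rw [hdmod, logDiff_ratPoint, hq, Cor22.logCondAvoid_reyssat hlp (by omega) (by omega) (by omega),
    Cor22.logQAvoid_reyssat hlp (by omega) (by omega) (by omega)]
  obtain ⟨hkey₁, hkey₂⟩ := ReyssatM.key_ineq_log_higher
  have h3 : 0 < Real.log 3 := Real.log_pos (by norm_num)
  have h23 : 0 < Real.log 23 := Real.log_pos (by norm_num)
  have h109 : 0 < Real.log 109 := Real.log_pos (by norm_num)
  have hpi : 0 < Real.log Real.pi := Real.log_pos (by have := Real.pi_gt_three; linarith)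
  rcases hl with rfl | rfl
  · push_cast
    nlinarith [hkey₁, h3, h23, h109, hpi]
  · push_cast
    nlinarith [hkey₂, h3, h23, h109, hpi]

/-- **The datum type at `(ratPoint (2/23⁵), l)`, `l ∈ {17, 19}`, is INHABITED** — with NO hypothesis: `ThetaPartII.stub_thetaData` at the admissible pair,
(P6) being abc-iut-w6-d102's THEOREMS `FreyP6Reyssat.condP6_seventeen / _nineteen` (p482354). [cite: Mochizuki2012, IUTchIV Cor. 2.2 (ii) proof (P7) p. 46]
[claim: Mochizuki2012, status: disputed] -/
theorem ReyssatM.nonempty_thetaVolumeDatumAt_of_eq {l : ℕ} (hl : l = 17 ∨ l = 19) :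
    Nonempty (Cor22.ThetaVolumeDatumAt (ratPoint (((2 : ℕ) : ℚ) / (23 ^ 5 : ℕ))) l) := by
  have h6 : Cor22.CondP6 (ratPoint (((2 : ℕ) : ℚ) / (23 ^ 5 : ℕ))) l := by
    rcases hl with rfl | rfl
    · exact FreyP6Reyssat.condP6_seventeen
    · exact FreyP6Reyssat.condP6_nineteen
  exact ThetaPartII.stub_thetaData (ratPoint (((2 : ℕ) : ℚ) / (23 ^ 5 : ℕ))) ReyssatM.mem_UP l
    (by rcases hl with rfl | rfl <;> norm_num) (by rcases hl with rfl | rfl <;> norm_num) ReyssatM.admitsCore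
    (ReyssatM.condP2_of_eq hl) (ReyssatM.condP5_of_eq hl) h6

end Summit.ABC.IUTFork.Conditional

end
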